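import Literature.NumberTheory.EllipticCurves.KatoAdditiveTwistedValueNeronIntegralityThreeKP
import Literature.NumberTheory.EllipticCurves.KatoAdditiveTwistedValueNeronIntegralitySymbolClosure
import HarnessLib

/-!
# F₃♮ ⟹ F₃: proved rewritings of the Kosters–Pannekoek-indexed Kato fact at `3`

Theorem-only sibling of `KatoAdditiveTwistedValueNeronIntegralityThreeKP.lean` (statement-only): the value set of
`kpSignThree`, the implication «`χ(3) ∉ {1, −1}` ⟹ `χ(3)·ā ≠ 1`», and the three PROVED edges F₃♮ ⟹ F₃,
F₃♮-at ⟹ F₃-at, F₃♮ ⟹ F₃♮-at (on the `E[3]`-irreducible locus).  Cell `bsd-f2-manin`, planner es g22 (MEMO-es §36),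
HOME/es/Sketch-es-g22.lean sha16 14d471371a4b85c6 §1 (unchanged through v3 20af58d791d39f75) VERBATIM; typer g14, T-es-29 (a).  Nothing about BSD or Manin's
`c = 1` is proved by this.
-/

noncomputable section

open scoped MatrixGroups ModularForm Classical

open CongruenceSubgroup Literature.NumberTheory.EllipticCurves.ModularForms

namespace Literature.NumberTheory.EllipticCurves

/-- `ā(V) ∈ {0, 1, −1}`. (es g22 VERBATIM.) [cite: KostersPannekoek2017, Thm. 1 (ii) (the three cases)] -/
lemma kpSignThree_mem (V : WeierstrassCurve ℚ) :
    kpSignThree V = 0 ∨ kpSignThree V = 1 ∨ kpSignThree V = -1 := by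
  unfold kpSignThree; split_ifs <;> simp

/-- The curve-free clauses imply the K–P clause: `χ(3) ∉ {1, −1}` ⟹ `χ(3)·ā ≠ 1` for every `ā ∈ {0, 1, −1}`.
(es g22 VERBATIM.) [cite: KostersPannekoek2017, Thm. 1 (ii)] -/
lemma mul_kpSignThree_ne_one {m : ℕ} (χ : DirichletCharacter ℂ m) (V : WeierstrassCurve ℚ)
    (h3 : χ (3 : ZMod m) ≠ 1) (h3' : χ (3 : ZMod m) ≠ -1) : χ (3 : ZMod m) * kpSignThree V ≠ 1 := by
  rcases kpSignThree_mem V with h | h | h <;> rw [h]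
  · simp
  · simpa using h3
  · intro hx; apply h3'; linear_combination -hx

/-- **F₃♮ ⟹ F₃** (`χ(3) ∉ {±1}` ⟹ `χ(3)·ā ≠ 1`). (es g22 VERBATIM.)
[cite: Kato2004Asterisque, Thm. 6.6 (1) (p. 163)] -/
theorem polar_of_kp (h : kato_neron_isIntegral_twistedSymbolSum_of_additive_three_kp) :
    kato_neron_isIntegral_twistedSymbolSum_of_additive_three_polar :=
  fun V _ _ _ _ f hf hg hm hirr m _ hcop χ hprim h1 hord h3 h3' ϖ r ↦
    h V f hf hg hm hirr m hcop χ hprim h1 hord (mul_kpSignThree_ne_one χ V h3 h3') ϖ r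

/-- **F₃♮-at ⟹ F₃-at.** (es g22 VERBATIM.) [cite: Kato2004Asterisque, Thm. 6.6 (1) (p. 163)] -/
theorem katoFactThreeAt_of_kp (V : WeierstrassCurve ℚ) [V.IsElliptic] [V.IsGloballyMinimal] {N : ℕ}
    [NeZero N] (f : CuspForm (Gamma0 N) 2) (h : KatoFactThreeAtKP V f) : KatoFactThreeAt V f :=
  fun hf hg hm m _ hcop χ hprim h1 hord h3 h3' ϖ r ↦
    h hf hg hm m hcop χ hprim h1 hord (mul_kpSignThree_ne_one χ V h3 h3') ϖ r

/-- On the `E[3]`-irreducible locus F₃♮-at IS an instance of the fact F₃♮. (es g22 VERBATIM.)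
[cite: Kato2004Asterisque, remark after (12.8.1) (p. 223)] -/
theorem katoFactThreeAtKP_of_kp (h : kato_neron_isIntegral_twistedSymbolSum_of_additive_three_kp)
    (V : WeierstrassCurve ℚ) [V.IsElliptic] [V.IsGloballyMinimal] {N : ℕ} [NeZero N]
    (f : CuspForm (Gamma0 N) 2) (hirr : V.HasIrreducibleModPGaloisRep 3) : KatoFactThreeAtKP V f :=
  fun hf hg hm m _ hcop χ hprim h1 hord h3 ϖ r ↦
    h V f hf hg hm hirr m hcop χ hprim h1 hord h3 ϖ r

end Literature.NumberTheory.EllipticCurves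

end
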